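import Summits.Ventures.PercRepro2.UnionRowKGen
/-!
# The union row times the mass of the union event: `V·M(U) = Z²·Cov_U(A,B) + Cov(A,U)·Cov(B,U)`
(blind cell PercRepro2, mine-1 g42; companion of `UnionRowCovSplit`)

Setting of `UnionRowPeel`: cells `ι`, masses `m`, a cut set `D`, `U = univ \ D` the union event, cell sets `A`, `B`,
`rowV m D A B = Σ_{c ∈ U} m c (Z·1_A(c) − M(A)) (Z·1_B(c) − M(B))`.  With the covariance inside `U`,
`Cov_U(A,B) = M(U)·M(A∩B∩U) − M(A∩U)·M(B∩U)`, and the covariances of `A`, `B` with the union event itself,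
`Cov(A,U) = Z·M(A∩U) − M(A)·M(U)`:

    `rowV m D A B · M(U) = Z²·Cov_U(A,B) + Cov(A,U)·Cov(B,U)`      (`rowV_mul_massU`), exactly.

So, given positive association of `A`, `B` inside the union event (row 2′CON-U's (UNION-PA)), the union row holds as soon
as `A` and `B` DRIFT THE SAME WAY between the union event and the double-hit event — `Cov(A,U)` and `Cov(B,U)` of one
sign, i.e. `(P(A|U) − P(A|D))·(P(B|U) − P(B|D)) ≥ 0` — and it can fail only when they drift apart by more than
`Z²·Cov_U` (`rowV_nonneg_of_drift`).  For the k = 3 obstructions of the avoidance-PA cone (mine-1 g42) the spectator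
coordinate is exactly what lets one observable drift against the other.
-/

namespace Summit.Ventures.PercRepro2.UnionRowCovDrift

open Finset
open Summit.Ventures.PercRepro2.UnionRowPeel
open Summit.Ventures.PercRepro2.UnionRowKGen

variable {ι : Type*} [Fintype ι] [DecidableEq ι]

/-- `V·M(U) = Z²·(M(U)·M(A∩B∩U) − M(A∩U)·M(B∩U)) + (Z·M(A∩U) − M(A)·M(U))·(Z·M(B∩U) − M(B)·M(U))`, `U = univ \ D`. -/
theorem rowV_mul_massU (m : ι → ℝ) (D A B : Finset ι) :
    rowV m D A B * mass m (univ \ D)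
      = mass m univ ^ 2
          * (mass m (univ \ D) * mass m ((A ∩ B) \ D) - mass m (A \ D) * mass m (B \ D))
        + (mass m univ * mass m (A \ D) - mass m A * mass m (univ \ D))
          * (mass m univ * mass m (B \ D) - mass m B * mass m (univ \ D)) := by
  rw [rowV_expand]; ring

/-- Given `Cov_U(A,B) ≥ 0` and `Cov(A,U)·Cov(B,U) ≥ 0`, the row is nonnegative (nonnegative masses, `M(U) > 0`). -/
theorem rowV_nonneg_of_drift {m : ι → ℝ} (hm : ∀ x, 0 ≤ m x) (D A B : Finset ι)
    (hUpos : 0 < mass m (univ \ D))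
    (hU : 0 ≤ mass m (univ \ D) * mass m ((A ∩ B) \ D) - mass m (A \ D) * mass m (B \ D))
    (hdrift : 0 ≤ (mass m univ * mass m (A \ D) - mass m A * mass m (univ \ D))
        * (mass m univ * mass m (B \ D) - mass m B * mass m (univ \ D))) :
    0 ≤ rowV m D A B := by
  have h := rowV_mul_massU m D A B
  have hZ := mass_nonneg hm univ
  have key : 0 ≤ rowV m D A B * mass m (univ \ D) := by
    rw [h]; nlinarith [mul_nonneg (mul_nonneg hZ hZ) hU]
  nlinarith [key, hUpos]

end Summit.Ventures.PercRepro2.UnionRowCovDrift
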